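import Summits.QuantumFields.YangMills.Theorems.PoincareLipschitzCovariantCaccioppoli
import HarnessLib

/-!
# Line «poincare_lipschitz» on crux `HistoryTailL` (stmt-QuantumFields-19936), route crux `BlockLipschitzL` (stmt-QuantumFields-23533), K2 supplier plan,
# (R3)-COV brick (W1) — THE COVARIANT ONE-FORM SOURCE IDENTITY ON `ℤ^d`: for a bond field `Y` and a connection by linear isometries,
# `(Σ_ν D*_νD_ν)Y_μ = Σ_ν D*_ν G_μ(·,ν) + E_μ` EXACTLY, with `G_μ(x,ν) = curl Y(x;ν,μ) − [ν = μ]·τ μ x (div Y)(x+e_μ)` (divergence-form data of size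
# `κ + δ` when `‖curl Y‖ ≤ κ`, `‖div Y‖ ≤ δ`) and `E_μ = Σ_ν [D*_ν, D_μ]Y_ν` the CURVATURE COMMUTATOR, `‖E_μ(y)‖ ≤ θ·Σ_{ν≠μ}‖Y_ν(y−e_ν+e_μ)‖` when every
# plaquette holonomy is within `θ` of the identity — the Weitzenböck bookkeeping of the covariant road, genuinely covariant, NO smallness of the links

Cell `ym3-torus` (YM ladder rung R3 = continuum SU(2) Yang–Mills on the three-torus — a RUNG, NOT the Clay problem: not d = 4, not infinite volume, not a
mass gap); width seat `ym-ust-19936-w5` gen 11 (bus 2026-08-29T01:4xZ CLAIM «COV-ONE-FORM-SOURCE»; LEAD ym-ust-19936-w1 g7 card v1.29 (c) ∕ 01:03:24Z (c)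
«`θ` enters ONLY through the curvature term `𝒦Y` of the Weitzenböck form»; px7 g4 01:36:16Z no objection, «COV-ONE-FORM-MV» reads `G_μ`∕`E_μ` by name).
THEOREMS ONLY (def-free), in the letters of ✓`PoincareLipschitzCovariantCaccioppoli` (ym3-torus-px7 g4) VERBATIM; `--supports stmt-QuantumFields-19936`.
Nothing here proves the (R3)-COV row, `hStab`, F5/F6, a stub, `BlockLipschitzL`, `HistoryTailL` or a summit statement.

WHY.  The (R3)-COV row of record (card v1.28 (c)) bounds a 1-form `Y` with small covariant divergence (`‖D*_UY‖ ≤ δ`, the linearised Coulomb condition of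
the orbit minimiser, ★w5 g10 ✓`norm_covDiv_le_of_orbitMin`) and small covariant curl (`‖curl_UY‖ ≤ κ`, both fields good) in sup by its box `ℓ²`-mass.  The
flat road does this component by component (✓`Prop7FlatSourcedMeanValue.sq_le_of_curl_div_bounds`: `−ΔX_μ = ∂*G_μ`, `G_μ(y,ν) = C_X(y;ν,μ) − [ν = μ]·∂*X(y+e_μ)`,
using `∂*_ν∂_μ = ∂_μ∂*_ν`).  Covariantly the mixed second differences do NOT commute: `[D*_ν, D_μ]f(y) = ((τ ν (y−e_ν))⁻¹∘τ μ (y−e_ν) − τ μ y∘(τ ν (y−e_ν+e_μ))⁻¹)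
f(y−e_ν+e_μ)` = (plaquette holonomy − 1) ∘ isometry — print's curvature operator `𝒦` of the Weitzenböck identity (✓`B11Eq135Weitzenbock` in carrier letters).
This file writes the identity and the two size rows in the (V, τ) letters of the covariant road, so that «COV-ONE-FORM-MV» (px7) = ✓COV-DIRICHLET §5–§6
(★w5 g11 p686449) + COV-DIRICHLET-SUP (px7) + ✓COV-ANTIDERIV (★w5 g11, the bounded source `E_μ` as divergence-form data at the price `2R+1`) assembles the
(R3)-COV row shape with the located extra slot `≍ R²θ·sup‖Y‖` (px7 (R3)-LIN v2 §9: absorbable iff `R²θ ≲ 1`, the `3K∕4` wall).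

SETTING (abstract; def-free; px7's letters).  `V` a real inner-product space; `τ : Fin d → ℤ^d → (V ≃ₗᵢ[ℝ] V)`, `τ μ y` the transport from the fibre at `y + e_μ`
to the fibre at `y`; `D_μf(y) = τ μ y (f(y+e_μ)) − f(y)`, `D*_μG(y) = (τ μ (y−e_μ))⁻¹(G(y−e_μ)) − G(y)`.  For a bond field `Y : ℤ^d → Fin d → V` the covariant
curl and divergence are taken as NAMED HYPOTHESES (`hC : C x ν μ = D_νY_μ(x) − D_μY_ν(x)`, `hDv : Dv x = Σ_ν D*_νY_ν(x)`), so the statements read in the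
consumer's letters and instantiate by `rfl`.  The plaquette holonomy at `x` in the plane `(μ, ν)` is `τ μ x ∘ τ ν (x+e_μ) ∘ (τ μ (x+e_ν))⁻¹ ∘ (τ ν x)⁻¹`
(instance of record: `Ad(U(∂p))`, ✓`B9Eq39Adjoint.plaqU`).

* §1 ★ `norm_holDefect_le` — four isometries `A B C D` with `‖A(B(C⁻¹(D⁻¹v))) − v‖ ≤ θ‖v‖` ⇒ `‖D⁻¹(Au) − C(B⁻¹u)‖ ≤ θ‖u‖` (the commutator is the holonomy
  defect conjugated by isometries); `covDvg_add` (the divergence letter is additive in the data).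
* §2 ★★★ `covLop_oneForm_eq` — THE IDENTITY `(Σ_νD*_νD_ν)Y_μ(y) = Σ_ν D*_ν[G_μ(·,ν)](y) + E_μ(y)`, `E_μ(y) = Σ_ν ((τ ν (y−e_ν))⁻¹(τ μ (y−e_ν)(Y_ν(y−e_ν+e_μ))) −
  τ μ y ((τ ν (y−e_ν+e_μ))⁻¹(Y_ν(y−e_ν+e_μ))))` (the `ν = μ` term is `0`).
* §3 ★ `norm_oneFormData_le` (`‖G_μ(x,ν)‖ ≤ κ + δ`), `comm_self_eq_zero`, ★★ `norm_curvTerm_le` (`‖E_μ(y)‖ ≤ θ·Σ_{ν ≠ μ}‖Y_ν(y−e_ν+e_μ)‖` under the plaquette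
  hypothesis at the `d − 1` plaquettes `(y−e_ν; μ, ν)`), ★ `norm_curvTerm_le_of_sup` (`≤ θ·(d−1)·S`).
[folklore] (lattice Weitzenböck bookkeeping; [Balaban1985BackgroundPropagators] (3.3), (3.8), (3.23)–(3.25) pp.391–394 are the print loci of the covariant letters;
[Giaquinta1984] Ch. III §2 for the flat road being perturbed).
-/

set_option autoImplicit false

noncomputable section

open scoped BigOperators
open Finset

namespace Summit.QuantumFields.YangMills.Theorems.PoincareLipschitzCovariantOneFormSource

open Literature.MathematicalPhysics.QuantumFieldTheory.Balaban1983to89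
open B4Eq19LatticeOperators

variable {d : ℕ} {V : Type*} [NormedAddCommGroup V] [InnerProductSpace ℝ V]

/-! ## §1 The holonomy defect behind the commutator; additivity of the divergence letter -/

/-- ★ **THE COMMUTATOR IS A CONJUGATED HOLONOMY DEFECT**: for linear isometries `A B C D` of `V`, if the «holonomy» `A∘B∘C⁻¹∘D⁻¹` is within `θ` of the identity
(`‖A(B(C⁻¹(D⁻¹v))) − v‖ ≤ θ‖v‖` for all `v`), then `‖D⁻¹(Au) − C(B⁻¹u)‖ ≤ θ‖u‖` for all `u`
(`D⁻¹A − CB⁻¹ = D⁻¹∘(ABC⁻¹D⁻¹ − 1)∘(DCB⁻¹)`, and `D⁻¹`, `DCB⁻¹` preserve norms). [folklore] [cite: Balaban1985BackgroundPropagators, (3.24)-(3.25) p.394] -/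
theorem norm_holDefect_le (A B C D : V ≃ₗᵢ[ℝ] V) {θ : ℝ} (h : ∀ v : V, ‖A (B (C.symm (D.symm v))) - v‖ ≤ θ * ‖v‖) (u : V) :
    ‖D.symm (A u) - C (B.symm u)‖ ≤ θ * ‖u‖ := by
  set w : V := D (C (B.symm u)) with hw
  have key : D.symm (A u) - C (B.symm u) = D.symm (A (B (C.symm (D.symm w))) - w) := by
    rw [hw, map_sub, LinearIsometryEquiv.symm_apply_apply, LinearIsometryEquiv.symm_apply_apply, LinearIsometryEquiv.apply_symm_apply]
  have hnw : ‖w‖ = ‖u‖ := by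
    rw [hw, LinearIsometryEquiv.norm_map, LinearIsometryEquiv.norm_map, LinearIsometryEquiv.norm_map]
  rw [key, LinearIsometryEquiv.norm_map, ← hnw]
  exact h w

/-- The covariant divergence letter is additive in the data. [folklore] [cite: Balaban1985BackgroundPropagators, (3.8) p.392] -/
theorem covDvg_add (τ : Fin d → Zd d → (V ≃ₗᵢ[ℝ] V)) (g₁ g₂ : Zd d → Fin d → V) (y : Zd d) :
    ∑ ν, ((τ ν (y - unitVec ν)).symm (g₁ (y - unitVec ν) ν + g₂ (y - unitVec ν) ν) - (g₁ y ν + g₂ y ν)) =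
      (∑ ν, ((τ ν (y - unitVec ν)).symm (g₁ (y - unitVec ν) ν) - g₁ y ν)) + ∑ ν, ((τ ν (y - unitVec ν)).symm (g₂ (y - unitVec ν) ν) - g₂ y ν) := by
  rw [← Finset.sum_add_distrib]
  refine Finset.sum_congr rfl fun ν _ => ?_
  rw [map_add]; abel

/-! ## §2 The one-form source identity -/

/-- ★★★ **THE COVARIANT ONE-FORM SOURCE IDENTITY.**  For a bond field `Y : ℤ^d → Fin d → V`, its covariant curl `C x ν μ = D_νY_μ(x) − D_μY_ν(x)` and covariant
divergence `Dv x = Σ_ν D*_νY_ν(x)` (named hypotheses), every site `y` and direction `μ`: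
`(Σ_ν D*_νD_ν)Y_μ(y) = Σ_ν D*_ν[x ↦ C x ν μ − [ν = μ]·τ μ x (Dv(x+e_μ))](y) + E_μ(y)` with the CURVATURE COMMUTATOR
`E_μ(y) = Σ_ν ((τ ν (y−e_ν))⁻¹(τ μ (y−e_ν)(Y_ν(y−e_ν+e_μ))) − τ μ y ((τ ν (y−e_ν+e_μ))⁻¹(Y_ν(y−e_ν+e_μ))))` (`= Σ_ν [D*_ν, D_μ]Y_ν(y)`; the flat
`∂_μ(div) = −∂*_μ(div(·+e_μ))` became `D_μ(Dv) = D*_μ(−τ μ · Dv(·+e_μ))` EXACTLY).  Pure algebra; NO hypothesis on the connection. [folklore]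
[cite: Balaban1985BackgroundPropagators, (3.23)-(3.25) p.394] -/
theorem covLop_oneForm_eq (τ : Fin d → Zd d → (V ≃ₗᵢ[ℝ] V)) (Y : Zd d → Fin d → V) (C : Zd d → Fin d → Fin d → V) (Dv : Zd d → V)
    (hC : ∀ (x : Zd d) (ν μ : Fin d), C x ν μ = (τ ν x (Y (x + unitVec ν) μ) - Y x μ) - (τ μ x (Y (x + unitVec μ) ν) - Y x ν))
    (hDv : ∀ x : Zd d, Dv x = ∑ ν, ((τ ν (x - unitVec ν)).symm (Y (x - unitVec ν) ν) - Y x ν)) (y : Zd d) (μ : Fin d) :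
    ∑ ν, ((Y y μ + Y y μ) - (τ ν (y - unitVec ν)).symm (Y (y - unitVec ν) μ) - τ ν y (Y (y + unitVec ν) μ)) =
      (∑ ν, ((τ ν (y - unitVec ν)).symm (C (y - unitVec ν) ν μ - (if ν = μ then τ μ (y - unitVec ν) (Dv (y - unitVec ν + unitVec μ)) else 0)) -
          (C y ν μ - (if ν = μ then τ μ y (Dv (y + unitVec μ)) else 0)))) +
        ∑ ν, ((τ ν (y - unitVec ν)).symm (τ μ (y - unitVec ν) (Y (y - unitVec ν + unitVec μ) ν)) -
          τ μ y ((τ ν (y - unitVec ν + unitVec μ)).symm (Y (y - unitVec ν + unitVec μ) ν))) := by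
  classical
  -- the Kronecker part of the data: `Σ_ν D*_ν[[ν = μ]·τ μ · Dv(·+e_μ)](y) = Dv(y) − τ μ y (Dv(y+e_μ)) = −D_μ(Dv)(y)`
  have hK : ∑ ν, ((τ ν (y - unitVec ν)).symm (if ν = μ then τ μ (y - unitVec ν) (Dv (y - unitVec ν + unitVec μ)) else 0) -
      (if ν = μ then τ μ y (Dv (y + unitVec μ)) else 0)) = Dv y - τ μ y (Dv (y + unitVec μ)) := by
    rw [Finset.sum_sub_distrib]
    have h1 : ∑ ν, (τ ν (y - unitVec ν)).symm (if ν = μ then τ μ (y - unitVec ν) (Dv (y - unitVec ν + unitVec μ)) else 0) = Dv y := by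
      rw [Finset.sum_eq_single μ (fun ν _ hν => by rw [if_neg hν, map_zero]) (fun h => absurd (Finset.mem_univ μ) h)]
      rw [if_pos rfl, LinearIsometryEquiv.symm_apply_apply, sub_add_cancel]
    have h2 : ∑ ν, (if ν = μ then τ μ y (Dv (y + unitVec μ)) else 0) = τ μ y (Dv (y + unitVec μ)) := by
      rw [Finset.sum_ite_eq' Finset.univ μ, if_pos (Finset.mem_univ μ)]
    rw [h1, h2]
  -- split the data sum into its curl part and its Kronecker part
  have hsplit : ∑ ν, ((τ ν (y - unitVec ν)).symm (C (y - unitVec ν) ν μ - (if ν = μ then τ μ (y - unitVec ν) (Dv (y - unitVec ν + unitVec μ)) else 0)) -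
      (C y ν μ - (if ν = μ then τ μ y (Dv (y + unitVec μ)) else 0))) =
      (∑ ν, ((τ ν (y - unitVec ν)).symm (C (y - unitVec ν) ν μ) - C y ν μ)) -
        ∑ ν, ((τ ν (y - unitVec ν)).symm (if ν = μ then τ μ (y - unitVec ν) (Dv (y - unitVec ν + unitVec μ)) else 0) -
          (if ν = μ then τ μ y (Dv (y + unitVec μ)) else 0)) := by
    rw [← Finset.sum_sub_distrib]
    refine Finset.sum_congr rfl fun ν _ => ?_
    rw [map_sub]; abel
  -- the pointwise identity: LHS summand = curl-data summand + commutator − (div summand at y) + τ μ y (div summand at y+e_μ)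
  have hpt : ∀ ν : Fin d,
      (Y y μ + Y y μ) - (τ ν (y - unitVec ν)).symm (Y (y - unitVec ν) μ) - τ ν y (Y (y + unitVec ν) μ) =
        ((τ ν (y - unitVec ν)).symm (C (y - unitVec ν) ν μ) - C y ν μ) +
          ((τ ν (y - unitVec ν)).symm (τ μ (y - unitVec ν) (Y (y - unitVec ν + unitVec μ) ν)) -
            τ μ y ((τ ν (y - unitVec ν + unitVec μ)).symm (Y (y - unitVec ν + unitVec μ) ν))) -
          ((τ ν (y - unitVec ν)).symm (Y (y - unitVec ν) ν) - Y y ν) +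
          τ μ y ((τ ν (y + unitVec μ - unitVec ν)).symm (Y (y + unitVec μ - unitVec ν) ν) - Y (y + unitVec μ) ν) := by
    intro ν
    have e : y + unitVec μ - unitVec ν = y - unitVec ν + unitVec μ := by abel
    rw [hC, hC, e]
    simp only [map_sub, LinearIsometryEquiv.symm_apply_apply, sub_add_cancel]
    abel
  have hQ : ∑ ν, τ μ y ((τ ν (y + unitVec μ - unitVec ν)).symm (Y (y + unitVec μ - unitVec ν) ν) - Y (y + unitVec μ) ν) =
      τ μ y (Dv (y + unitVec μ)) := by
    rw [hDv, map_sum]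
  calc ∑ ν, ((Y y μ + Y y μ) - (τ ν (y - unitVec ν)).symm (Y (y - unitVec ν) μ) - τ ν y (Y (y + unitVec ν) μ))
      = ∑ ν, (((τ ν (y - unitVec ν)).symm (C (y - unitVec ν) ν μ) - C y ν μ) +
          ((τ ν (y - unitVec ν)).symm (τ μ (y - unitVec ν) (Y (y - unitVec ν + unitVec μ) ν)) -
            τ μ y ((τ ν (y - unitVec ν + unitVec μ)).symm (Y (y - unitVec ν + unitVec μ) ν))) -
          ((τ ν (y - unitVec ν)).symm (Y (y - unitVec ν) ν) - Y y ν) +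
          τ μ y ((τ ν (y + unitVec μ - unitVec ν)).symm (Y (y + unitVec μ - unitVec ν) ν) - Y (y + unitVec μ) ν)) :=
        Finset.sum_congr rfl fun ν _ => hpt ν
    _ = (∑ ν, ((τ ν (y - unitVec ν)).symm (C (y - unitVec ν) ν μ) - C y ν μ)) +
          (∑ ν, ((τ ν (y - unitVec ν)).symm (τ μ (y - unitVec ν) (Y (y - unitVec ν + unitVec μ) ν)) -
            τ μ y ((τ ν (y - unitVec ν + unitVec μ)).symm (Y (y - unitVec ν + unitVec μ) ν)))) -
          (∑ ν, ((τ ν (y - unitVec ν)).symm (Y (y - unitVec ν) ν) - Y y ν)) +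
          ∑ ν, τ μ y ((τ ν (y + unitVec μ - unitVec ν)).symm (Y (y + unitVec μ - unitVec ν) ν) - Y (y + unitVec μ) ν) := by
        rw [Finset.sum_add_distrib, Finset.sum_sub_distrib, Finset.sum_add_distrib]
    _ = _ := by
        rw [hQ, ← hDv y, hsplit, hK]
        abel

/-! ## §3 The sizes of the data and of the curvature term -/

/-- ★ **SIZE OF THE DIVERGENCE-FORM DATA**: `‖C x ν μ‖ ≤ κ` and `‖Dv(x+e_μ)‖ ≤ δ` (`δ ≥ 0`) give `‖G_μ(x,ν)‖ = ‖C x ν μ − [ν = μ]·τ μ x (Dv(x+e_μ))‖ ≤ κ + δ`.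
[folklore] [cite: Balaban1985BackgroundPropagators, (3.8) p.392] -/
theorem norm_oneFormData_le (τ : Fin d → Zd d → (V ≃ₗᵢ[ℝ] V)) (C : Zd d → Fin d → Fin d → V) (Dv : Zd d → V) (x : Zd d) (ν μ : Fin d) {κ δ : ℝ}
    (hκ : ‖C x ν μ‖ ≤ κ) (hδ0 : 0 ≤ δ) (hδ : ‖Dv (x + unitVec μ)‖ ≤ δ) :
    ‖C x ν μ - (if ν = μ then τ μ x (Dv (x + unitVec μ)) else 0)‖ ≤ κ + δ := by
  refine (norm_sub_le _ _).trans (add_le_add hκ ?_)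
  by_cases h : ν = μ
  · rw [if_pos h, LinearIsometryEquiv.norm_map]; exact hδ
  · rw [if_neg h, norm_zero]; exact hδ0

/-- The `ν = μ` term of the curvature commutator vanishes identically. [folklore] [cite: Balaban1985BackgroundPropagators, (3.24) p.394] -/
theorem comm_self_eq_zero (τ : Fin d → Zd d → (V ≃ₗᵢ[ℝ] V)) (Y : Zd d → Fin d → V) (y : Zd d) (μ : Fin d) :
    (τ μ (y - unitVec μ)).symm (τ μ (y - unitVec μ) (Y (y - unitVec μ + unitVec μ) μ)) -
      τ μ y ((τ μ (y - unitVec μ + unitVec μ)).symm (Y (y - unitVec μ + unitVec μ) μ)) = 0 := by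
  rw [sub_add_cancel, LinearIsometryEquiv.symm_apply_apply, LinearIsometryEquiv.apply_symm_apply, sub_self]

/-- ★★ **SIZE OF THE CURVATURE TERM**: if the holonomy of each of the `d − 1` plaquettes `(y−e_ν; μ, ν)`, `ν ≠ μ`, is within `θ` of the identity —
`‖τ μ (y−e_ν) (τ ν (y−e_ν+e_μ) ((τ μ y)⁻¹ ((τ ν (y−e_ν))⁻¹ v))) − v‖ ≤ θ‖v‖` — then
`‖E_μ(y)‖ ≤ θ·Σ_{ν ≠ μ} ‖Y_ν(y−e_ν+e_μ)‖`.  NO smallness of the links, only of the plaquettes. [folklore]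
[cite: Balaban1985BackgroundPropagators, (3.24)-(3.25) p.394] -/
theorem norm_curvTerm_le (τ : Fin d → Zd d → (V ≃ₗᵢ[ℝ] V)) (Y : Zd d → Fin d → V) (y : Zd d) (μ : Fin d) {θ : ℝ}
    (hHol : ∀ ν : Fin d, ν ≠ μ → ∀ v : V,
      ‖τ μ (y - unitVec ν) (τ ν (y - unitVec ν + unitVec μ) ((τ μ y).symm ((τ ν (y - unitVec ν)).symm v))) - v‖ ≤ θ * ‖v‖) :
    ‖∑ ν, ((τ ν (y - unitVec ν)).symm (τ μ (y - unitVec ν) (Y (y - unitVec ν + unitVec μ) ν)) -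
        τ μ y ((τ ν (y - unitVec ν + unitVec μ)).symm (Y (y - unitVec ν + unitVec μ) ν)))‖ ≤
      θ * ∑ ν ∈ Finset.univ.erase μ, ‖Y (y - unitVec ν + unitVec μ) ν‖ := by
  classical
  rw [← Finset.sum_erase_add _ _ (Finset.mem_univ μ), comm_self_eq_zero τ Y y μ, add_zero, Finset.mul_sum]
  refine (norm_sum_le _ _).trans (Finset.sum_le_sum fun ν hν => ?_)
  exact norm_holDefect_le (τ μ (y - unitVec ν)) (τ ν (y - unitVec ν + unitVec μ)) (τ μ y) (τ ν (y - unitVec ν))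
    (hHol ν (Finset.ne_of_mem_erase hν)) _

/-- ★ **SIZE OF THE CURVATURE TERM, SUP FORM**: under the same plaquette hypothesis and `‖Y_ν(y−e_ν+e_μ)‖ ≤ S` for `ν ≠ μ` (`θ ≥ 0`),
`‖E_μ(y)‖ ≤ θ·(d−1)·S` — print's `‖𝒦Y‖ ≲ θ·‖Y‖`. [folklore] [cite: Balaban1985BackgroundPropagators, (3.24)-(3.25) p.394] -/
theorem norm_curvTerm_le_of_sup (τ : Fin d → Zd d → (V ≃ₗᵢ[ℝ] V)) (Y : Zd d → Fin d → V) (y : Zd d) (μ : Fin d) {θ S : ℝ} (hθ : 0 ≤ θ)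
    (hHol : ∀ ν : Fin d, ν ≠ μ → ∀ v : V,
      ‖τ μ (y - unitVec ν) (τ ν (y - unitVec ν + unitVec μ) ((τ μ y).symm ((τ ν (y - unitVec ν)).symm v))) - v‖ ≤ θ * ‖v‖)
    (hS : ∀ ν : Fin d, ν ≠ μ → ‖Y (y - unitVec ν + unitVec μ) ν‖ ≤ S) :
    ‖∑ ν, ((τ ν (y - unitVec ν)).symm (τ μ (y - unitVec ν) (Y (y - unitVec ν + unitVec μ) ν)) -
        τ μ y ((τ ν (y - unitVec ν + unitVec μ)).symm (Y (y - unitVec ν + unitVec μ) ν)))‖ ≤ θ * (((d : ℝ) - 1) * S) := by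
  classical
  refine (norm_curvTerm_le τ Y y μ hHol).trans (mul_le_mul_of_nonneg_left ?_ hθ)
  calc ∑ ν ∈ Finset.univ.erase μ, ‖Y (y - unitVec ν + unitVec μ) ν‖ ≤ ∑ ν ∈ Finset.univ.erase μ, S :=
        Finset.sum_le_sum fun ν hν => hS ν (Finset.ne_of_mem_erase hν)
    _ = ((d : ℝ) - 1) * S := by
        rw [Finset.sum_const, Finset.card_erase_of_mem (Finset.mem_univ μ), Finset.card_univ, Fintype.card_fin, nsmul_eq_mul]
        have hd : 1 ≤ d := by
          have : 0 < Fintype.card (Fin d) := Fintype.card_pos_iff.mpr ⟨μ⟩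
          rwa [Fintype.card_fin] at this
        push_cast [Nat.cast_sub hd]
        ring

end Summit.QuantumFields.YangMills.Theorems.PoincareLipschitzCovariantOneFormSource

end
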